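import Literature.NumberTheory.EllipticCurves.IwasawaTwistModPDual
import HarnessLib

/-!
# K6 crux `MuTransferX9` (stmt-BirchSwinnertonDyer-19276), CORE-PLAN S4.3 design (KOLY-MEMO §5.11.B):
# UNIQUENESS of shift-compatible coefficient pairings on `𝒯_J × 𝒯_J^*` — a pairing family is determined
# by its values on constant vectors, and a rank-one-natural bilinear form is a multiple of `e`

Cell `bsd-smallim`, seat `bsd-smallim-koly` gen 7 (route `SmallImageMuTransfer`, rung K6, leaf
`Rank1Residual.BSDpOnClassX9`). HONEST FRAMING: pure algebra (no Galois group, no curve); no definition,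
no named fact, no `sorry`; nothing is booked. Serves the OPEN registered stub `stub_coreX9` of crux
19276 (skeleton v4 0154dd5daf38efd6) as the algebraic half of the DESIGN of record for CORE-PLAN S4.3
(MU-TRANSFER-PROOF Lemma 1 (iii) WITHOUT a tame-symbol fact, KOLY-MEMO v1.8.7 §5.11.B (N2)/(N4)), and
credits nothing toward its closure (`--supports … --as helper`). PARTITION (D-0054): X9 (A4) × p ∈ {5, 7}
— helper; closes NONE.

## Content (currency of k6-ty's `IwasawaTwistModPDual`: coordinate modules `Fin J → M`, shift `S`,
`Pi.single`, convolution coefficients `convCoeff e J k`)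

A COEFFICIENT PAIRING FAMILY is `Φ : ℕ → (Fin J → M) →+ (Fin J → M') →+ P` (think: `Φ k (x, y)` = the
coefficient of `T^k` of an `A_J`-valued pairing, e.g. `k ↦ inv_q(S^{J−1−k}_* x ∪ y)` for the local cup
product, or `k ↦ convCoeff e J k` for the Gorenstein pairing (F7)) that is SHIFT-COMPATIBLE:
`Φ_{k+1}(Sx, y) = Φ_k(x, y) = Φ_{k+1}(x, Sy)` (`k + 1 < J`) and `Φ_0(Sx, y) = 0 = Φ_0(x, Sy)` — the tree's
`convCoeff_succ_shiftEnd_left/right`, `convCoeff_zero_shiftEnd_left/right` say exactly that the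
convolution family is one.
* `shiftEnd_pow_single_zero` — `δ_a m = S^a δ_0 m`.
* `family_shiftEnd_pow_left/right` — `Φ_k(S^a x, y) = Φ_{k−a}(x, y)` if `a ≤ k`, else `0` (`k < J`).
* `family_single_single` — `Φ_k(δ_a m, δ_b m') = Φ_{k−a−b}(δ_0 m, δ_0 m')` if `a + b ≤ k`, else `0`.
* **`family_eq_of_single_zero_eq`** — TWO shift-compatible families with the same values on constant
  vectors `(δ_0 m, δ_0 m')` in every degree `< J` AGREE in every degree `< J` (expand `x = Σ δ_a x_a`).
* **`bilin_eq_mul_of_natural_rankOne`** — over a commutative ring `k`: a bilinear `b : V × V' → k` natural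
  for the RANK-ONE adjoint pairs of `e` (`b(e(v,w₁)v₂, w) = b(v, e(v₂,w)w₁)`; for `φ = e(·,w₁)v₂` the
  `e`-adjoint is `φ' = e(v₂,·)w₁`) is `b(v₀,w₀)·e` as soon as `e(v₀, w₀) = 1` — the Schur step (N4) of
  KOLY-MEMO §5.11.B in its sharpest elementary form (no "centre of a matrix algebra" needed).
* §3 (append no. 1) **`family_eq_weightedConv`** — the CLOSED FORM: a shift-compatible family with constant-vector
  values `u_k·e(m,m′)` is `Φ_k = Σ_{j≤k} u_j·C_{k−j}`, i.e. `Σ_k Φ_k T^k = u(T)·⟨·,·⟩_{A_J}`.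
Use (design §5.11.B): the local `tr × ur` cup-product family at an `E`-split prime is shift-compatible
(naturality in `S`) and natural for every `𝔽_p`-endomorphism of `E[p]` (trivial local action), so by
`bilin_eq_mul_of_natural_rankOne` its constant-vector values are `u_k·e`, and by `family_eq_of_single_zero_eq`
it equals the family `k ↦ Σ_{j≤k} u_j·C_{k−j}` = `u(T)·⟨·,·⟩_{A_J}` — the Gorenstein pairing up to the
power series `u`, a unit iff `u_0 ≠ 0` (perfectness); STEP 4 of Theorem A absorbs the unit.

References: HOME/koly/KOLY-MEMO.md §5.11.B (v1.8.7); HOME/koly/MU-TRANSFER-PROOF.md (F7), §2 Lemma 1 (iii);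
B. Mazur, K. Rubin, Mem. AMS 799 (2004) §1.3, Prop. 1.3.2 [MazurRubin2004]; B. Howard, Compositio 140
(2004) Prop. 3.2.4 [Howard2004HeegnerKolyvagin].
-/

set_option linter.dupNamespace false
set_option autoImplicit false

noncomputable section

open scoped Classical

namespace Summit.BirchSwinnertonDyer.BirchSwinnertonDyer.Rank1Residual.LocalSplitPrime

open Finset Literature.NumberTheory.EllipticCurves

/-! ## §1 Rank-one naturality pins a bilinear form to a multiple of `e` -/

section RankOne

variable {k V V' : Type*} [CommRing k] [AddCommGroup V] [Module k V] [AddCommGroup V'] [Module k V']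

/-- **Schur for rank-one adjoint pairs.**  If `b : V × V' → k` is bilinear and natural for the rank-one
pairs of `e` — `b(e(v,w₁)·v₂, w) = b(v, e(v₂,w)·w₁)` for all `v, v₂, w, w₁` (the `e`-adjoint of
`φ = e(·,w₁)v₂` is `φ' = e(v₂,·)w₁`) — and `e(v₀,w₀) = 1`, then `b = b(v₀,w₀)·e`.  (KOLY-MEMO §5.11.B
(N4): an `End(E[p])`-natural pairing on `E[p] × E[p]^*` is a scalar multiple of the evaluation.)
[cite: MazurRubin2004, §1.3 (Tate duality, the evaluation pairing)] -/
theorem bilin_eq_mul_of_natural_rankOne (e b : V →ₗ[k] V' →ₗ[k] k)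
    (hnat : ∀ (v v₂ : V) (w w₁ : V'), b (e v w₁ • v₂) w = b v (e v₂ w • w₁))
    {v₀ : V} {w₀ : V'} (h1 : e v₀ w₀ = 1) (v : V) (w : V') : b v w = b v₀ w₀ * e v w := by
  have h := hnat v₀ v w w₀
  rw [h1, one_smul, LinearMap.map_smul, smul_eq_mul, mul_comm] at h
  exact h

end RankOne

/-! ## §2 Shift-compatible coefficient families are determined by their values on constant vectors -/

section Family

variable {M M' P : Type*} [AddCommGroup M] [AddCommGroup M'] [AddCommGroup P] {J : ℕ}

/-- `δ_a m = S^a (δ_0 m)` on `Fin J → M`. [cite: Washington1997, §13.1–§13.2] -/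
theorem shiftEnd_pow_single_zero (a : Fin J) (m : M) :
    (shiftEnd M J ^ (a : ℕ)) (Pi.single (⟨0, Nat.lt_of_le_of_lt (Nat.zero_le _) a.2⟩ : Fin J) m) =
      Pi.single a m := by
  funext i
  rw [shiftEnd_pow_apply]
  by_cases h : (i : ℕ) < a
  · rw [dif_pos h, Pi.single_eq_of_ne]
    exact fun hi => by rw [hi] at h; exact lt_irrefl _ h
  · rw [dif_neg h]
    by_cases hi : i = a
    · subst hi
      rw [Pi.single_eq_same, show (⟨(i : ℕ) - i, by omega⟩ : Fin J) = ⟨0, by omega⟩ from Fin.ext (by simp),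
        Pi.single_eq_same]
    · rw [Pi.single_eq_of_ne hi, Pi.single_eq_of_ne]
      intro h0
      apply hi
      exact Fin.ext (by have := congrArg Fin.val h0; simp only at this; omega)

variable (Φ : ℕ → (Fin J → M) →+ (Fin J → M') →+ P)

/-- Iterated left shift: `Φ_k(S^a x, y) = Φ_{k−a}(x, y)` if `a ≤ k`, `= 0` if `a > k` (`k < J`), for a
left-shift-compatible family. [cite: Howard2004HeegnerKolyvagin, Prop. 3.2.4] -/
theorem family_shiftEnd_pow_left
    (hL0 : ∀ x y, Φ 0 (shiftEnd M J x) y = 0)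
    (hLs : ∀ (k : ℕ) x y, k + 1 < J → Φ (k + 1) (shiftEnd M J x) y = Φ k x y)
    (a : ℕ) {k : ℕ} (hk : k < J) (x : Fin J → M) (y : Fin J → M') :
    Φ k ((shiftEnd M J ^ a) x) y = if a ≤ k then Φ (k - a) x y else 0 := by
  induction a generalizing k x with
  | zero => simp
  | succ a ih =>
    rw [pow_succ, Module.End.mul_apply, ih hk]
    by_cases hak : a + 1 ≤ k
    · rw [if_pos hak, if_pos (by omega), show k - a = (k - (a + 1)) + 1 by omega, hLs _ _ _ (by omega)]
    · rw [if_neg hak]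
      by_cases hak' : a ≤ k
      · rw [if_pos hak', show k - a = 0 by omega, hL0]
      · rw [if_neg hak']

/-- Iterated right shift: `Φ_k(x, S^b y) = Φ_{k−b}(x, y)` if `b ≤ k`, `= 0` if `b > k` (`k < J`).
[cite: Howard2004HeegnerKolyvagin, Prop. 3.2.4] -/
theorem family_shiftEnd_pow_right
    (hR0 : ∀ x y, Φ 0 x (shiftEnd M' J y) = 0)
    (hRs : ∀ (k : ℕ) x y, k + 1 < J → Φ (k + 1) x (shiftEnd M' J y) = Φ k x y)
    (b : ℕ) {k : ℕ} (hk : k < J) (x : Fin J → M) (y : Fin J → M') :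
    Φ k x ((shiftEnd M' J ^ b) y) = if b ≤ k then Φ (k - b) x y else 0 := by
  induction b generalizing k y with
  | zero => simp
  | succ b ih =>
    rw [pow_succ, Module.End.mul_apply, ih hk]
    by_cases hbk : b + 1 ≤ k
    · rw [if_pos hbk, if_pos (by omega), show k - b = (k - (b + 1)) + 1 by omega, hRs _ _ _ (by omega)]
    · rw [if_neg hbk]
      by_cases hbk' : b ≤ k
      · rw [if_pos hbk', show k - b = 0 by omega, hR0]
      · rw [if_neg hbk']

/-- **A shift-compatible family on monomials**: `Φ_k(δ_a m, δ_b m') = Φ_{k−a−b}(δ_0 m, δ_0 m')` if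
`a + b ≤ k`, else `0` (`k < J`). [cite: Howard2004HeegnerKolyvagin, Prop. 3.2.4] -/
theorem family_single_single
    (hL0 : ∀ x y, Φ 0 (shiftEnd M J x) y = 0)
    (hLs : ∀ (k : ℕ) x y, k + 1 < J → Φ (k + 1) (shiftEnd M J x) y = Φ k x y)
    (hR0 : ∀ x y, Φ 0 x (shiftEnd M' J y) = 0)
    (hRs : ∀ (k : ℕ) x y, k + 1 < J → Φ (k + 1) x (shiftEnd M' J y) = Φ k x y)
    {k : ℕ} (hk : k < J) (a b : Fin J) (m : M) (m' : M') :
    Φ k (Pi.single a m) (Pi.single b m') =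
      if (a : ℕ) + b ≤ k then
        Φ (k - a - b) (Pi.single (⟨0, by omega⟩ : Fin J) m) (Pi.single (⟨0, by omega⟩ : Fin J) m')
      else 0 := by
  rw [← shiftEnd_pow_single_zero a m, ← shiftEnd_pow_single_zero b m',
    family_shiftEnd_pow_left Φ hL0 hLs a hk]
  by_cases ha : (a : ℕ) ≤ k
  · rw [if_pos ha, family_shiftEnd_pow_right Φ hR0 hRs b (by omega)]
    by_cases hab : (a : ℕ) + b ≤ k
    · rw [if_pos (by omega), if_pos hab]
    · rw [if_neg (by omega), if_neg hab]
  · rw [if_neg ha, if_neg (by omega)]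

omit [AddCommGroup P] in
/-- Bi-additive expansion: `Φ(x, y) = Σ_a Σ_b Φ(δ_a x_a, δ_b y_b)`. [folklore] -/
theorem biadditive_sum_single_single {P : Type*} [AddCommGroup P] (B : (Fin J → M) →+ (Fin J → M') →+ P)
    (x : Fin J → M) (y : Fin J → M') :
    B x y = ∑ a : Fin J, ∑ b : Fin J, B (Pi.single a (x a)) (Pi.single b (y b)) := by
  conv_lhs => rw [← Finset.univ_sum_single x, ← Finset.univ_sum_single y]
  rw [map_sum B, AddMonoidHom.finsetSum_apply]
  exact sum_congr rfl fun a _ => map_sum _ _ _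

/-- **UNIQUENESS.**  Two shift-compatible coefficient families with the same values on constant vectors
`(δ_0 m, δ_0 m')` in every degree `< J` agree in every degree `< J`.  With `bilin_eq_mul_of_natural_rankOne`
this is KOLY-MEMO §5.11.B (N2)+(N4): the `tr × ur` local cup-product family at an `E`-split prime equals
`u(T)·(Gorenstein family)` for the power series `u` of its constant-vector values.
[cite: Howard2004HeegnerKolyvagin, Prop. 3.2.4] [cite: MazurRubin2004, §1.3] -/
theorem family_eq_of_single_zero_eq (Ψ : ℕ → (Fin J → M) →+ (Fin J → M') →+ P)
    (hL0 : ∀ x y, Φ 0 (shiftEnd M J x) y = 0)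
    (hLs : ∀ (k : ℕ) x y, k + 1 < J → Φ (k + 1) (shiftEnd M J x) y = Φ k x y)
    (hR0 : ∀ x y, Φ 0 x (shiftEnd M' J y) = 0)
    (hRs : ∀ (k : ℕ) x y, k + 1 < J → Φ (k + 1) x (shiftEnd M' J y) = Φ k x y)
    (hL0' : ∀ x y, Ψ 0 (shiftEnd M J x) y = 0)
    (hLs' : ∀ (k : ℕ) x y, k + 1 < J → Ψ (k + 1) (shiftEnd M J x) y = Ψ k x y)
    (hR0' : ∀ x y, Ψ 0 x (shiftEnd M' J y) = 0)
    (hRs' : ∀ (k : ℕ) x y, k + 1 < J → Ψ (k + 1) x (shiftEnd M' J y) = Ψ k x y)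
    (hδ : ∀ k < J, ∀ (m : M) (m' : M') (h0 : 0 < J),
      Φ k (Pi.single (⟨0, h0⟩ : Fin J) m) (Pi.single (⟨0, h0⟩ : Fin J) m') =
        Ψ k (Pi.single (⟨0, h0⟩ : Fin J) m) (Pi.single (⟨0, h0⟩ : Fin J) m'))
    {k : ℕ} (hk : k < J) (x : Fin J → M) (y : Fin J → M') : Φ k x y = Ψ k x y := by
  rw [biadditive_sum_single_single (Φ k) x y, biadditive_sum_single_single (Ψ k) x y]
  refine sum_congr rfl fun a _ => sum_congr rfl fun b _ => ?_
  rw [family_single_single Φ hL0 hLs hR0 hRs hk, family_single_single Ψ hL0' hLs' hR0' hRs' hk]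
  split_ifs with hab
  · exact hδ _ (by omega) _ _ _
  · rfl

/-- The convolution family of k6-ty's `IwasawaTwistModPDual` is shift-compatible (re-export of
`convCoeff_zero/succ_shiftEnd_left/right` in the shape of the hypotheses above) and its values on
constant vectors are `C_k(δ_0 m, δ_0 m') = e(m, m')` for `k = 0` and `0` for `0 < k < J`.
[cite: MazurRubin2004, §1.3 and §5.3] -/
theorem convCoeff_single_zero_single_zero (e : M →+ M' →+ P) {k : ℕ} (hk : k < J) (m : M) (m' : M') :
    convCoeff e J k (Pi.single (⟨0, by omega⟩ : Fin J) m) (Pi.single (⟨0, by omega⟩ : Fin J) m') =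
      if k = 0 then e m m' else 0 := by
  rw [convCoeff_def]
  by_cases hk0 : k = 0
  · subst hk0
    rw [if_pos rfl, sum_range_one, Nat.sub_zero, coeffFun_of_lt _ hk, coeffFun_of_lt _ hk,
      Pi.single_eq_same, Pi.single_eq_same]
  · rw [if_neg hk0]
    refine sum_eq_zero fun a ha => ?_
    rw [mem_range] at ha
    by_cases ha0 : a = 0
    · subst ha0
      rw [coeffFun_of_lt _ (by omega : k - 0 < J), Pi.single_eq_of_ne, map_zero]
      exact fun h => hk0 (by have := congrArg Fin.val h; simpa using this)
    · rw [coeffFun_of_lt _ (by omega : a < J), Pi.single_eq_of_ne, map_zero, AddMonoidHom.zero_apply]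
      exact fun h => ha0 (by have := congrArg Fin.val h; simpa using this)

end Family

/-! ## §3 (append no. 1) The closed form: a natural shift-compatible family is `u(T)·(Gorenstein family)` -/

section Series

variable {M M' R : Type*} [AddCommGroup M] [AddCommGroup M'] [CommRing R] {J : ℕ}
  (e : M →+ M' →+ R) (u : ℕ → R)

/-- The `u`-weighted convolution family `Ψ^u_k(x, y) := Σ_{j ≤ k} u_j · C_{k−j}(x, y)` — the coefficient of
`T^k` in `u(T)·⟨x, y⟩_{A_J}` (`⟨x,y⟩_{A_J} = Σ_i C_i(x,y) T^i`, k6-ty's `gorensteinPairing_shiftEnd_pow_left`),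
as a value (no definition is introduced: the statements below quantify over this explicit sum).
It is SHIFT-COMPATIBLE on the left … [cite: MazurRubin2004, §1.3 and §5.3] -/
theorem weightedConv_succ_shiftEnd_left {k : ℕ} (hk : k + 1 < J) (x : Fin J → M) (y : Fin J → M') :
    ∑ j ∈ range (k + 2), u j * convCoeff e J (k + 1 - j) (shiftEnd M J x) y =
      ∑ j ∈ range (k + 1), u j * convCoeff e J (k - j) x y := by
  rw [sum_range_succ, Nat.sub_self, convCoeff_zero_shiftEnd_left, mul_zero, add_zero]
  refine sum_congr rfl fun j hj => ?_
  rw [mem_range] at hj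
  rw [show k + 1 - j = (k - j) + 1 by omega, convCoeff_succ_shiftEnd_left e (by omega)]

/-- … and on the right … [cite: MazurRubin2004, §1.3 and §5.3] -/
theorem weightedConv_succ_shiftEnd_right {k : ℕ} (hk : k + 1 < J) (x : Fin J → M) (y : Fin J → M') :
    ∑ j ∈ range (k + 2), u j * convCoeff e J (k + 1 - j) x (shiftEnd M' J y) =
      ∑ j ∈ range (k + 1), u j * convCoeff e J (k - j) x y := by
  rw [sum_range_succ, Nat.sub_self, convCoeff_zero_shiftEnd_right, mul_zero, add_zero]
  refine sum_congr rfl fun j hj => ?_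
  rw [mem_range] at hj
  rw [show k + 1 - j = (k - j) + 1 by omega, convCoeff_succ_shiftEnd_right e (by omega)]

/-- … vanishes in degree `0` on shifted vectors … [cite: MazurRubin2004, §1.3 and §5.3] -/
theorem weightedConv_zero_shiftEnd_left (x : Fin J → M) (y : Fin J → M') :
    ∑ j ∈ range 1, u j * convCoeff e J (0 - j) (shiftEnd M J x) y = 0 := by
  rw [sum_range_one, Nat.sub_zero, convCoeff_zero_shiftEnd_left, mul_zero]

/-- (right version). [cite: MazurRubin2004, §1.3 and §5.3] -/
theorem weightedConv_zero_shiftEnd_right (x : Fin J → M) (y : Fin J → M') :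
    ∑ j ∈ range 1, u j * convCoeff e J (0 - j) x (shiftEnd M' J y) = 0 := by
  rw [sum_range_one, Nat.sub_zero, convCoeff_zero_shiftEnd_right, mul_zero]

/-- … and its values on constant vectors are `u_k · e(m, m′)` (`k < J`). [cite: MazurRubin2004, §1.3 and §5.3] -/
theorem weightedConv_single_zero_single_zero {k : ℕ} (hk : k < J) (m : M) (m' : M') :
    ∑ j ∈ range (k + 1), u j * convCoeff e J (k - j) (Pi.single (⟨0, by omega⟩ : Fin J) m)
        (Pi.single (⟨0, by omega⟩ : Fin J) m') = u k * e m m' := by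
  rw [sum_eq_single_of_mem k (mem_range.2 (Nat.lt_succ_self k))]
  · rw [Nat.sub_self, convCoeff_single_zero_single_zero e (by omega : 0 < J), if_pos rfl]
  · intro j hj hjk
    rw [mem_range] at hj
    rw [convCoeff_single_zero_single_zero e (by omega : k - j < J), if_neg (by omega), mul_zero]

/-- **CLOSED FORM (KOLY-MEMO §5.11.B (N2)+(N4)+(N5)).**  A shift-compatible coefficient family
`Φ : ℕ → (Fin J → M) →+ (Fin J → M′) →+ R` whose values on constant vectors are `Φ_k(δ_0 m, δ_0 m′) =
u_k · e(m, m′)` (`k < J`) — e.g. by `bilin_eq_mul_of_natural_rankOne`, with `u_k := Φ_k(δ_0 v₀, δ_0 w₀)` —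
IS the `u`-weighted convolution family: `Φ_k(x, y) = Σ_{j ≤ k} u_j · C_{k−j}(x, y)`, i.e.
`Σ_k Φ_k T^k = u(T)·⟨x, y⟩_{A_J}`; `u` is a unit of `A_J` iff `u_0 ∈ R^×`.  At an `E`-split prime this is
"the `tr × ur` local pairing is the Gorenstein pairing up to a unit". [cite: MazurRubin2004, §1.3 and §5.3]
[cite: Howard2004HeegnerKolyvagin, Prop. 3.2.4] -/
theorem family_eq_weightedConv (Φ : ℕ → (Fin J → M) →+ (Fin J → M') →+ R)
    (hL0 : ∀ x y, Φ 0 (shiftEnd M J x) y = 0)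
    (hLs : ∀ (k : ℕ) x y, k + 1 < J → Φ (k + 1) (shiftEnd M J x) y = Φ k x y)
    (hR0 : ∀ x y, Φ 0 x (shiftEnd M' J y) = 0)
    (hRs : ∀ (k : ℕ) x y, k + 1 < J → Φ (k + 1) x (shiftEnd M' J y) = Φ k x y)
    (hδ : ∀ k < J, ∀ (m : M) (m' : M') (h0 : 0 < J),
      Φ k (Pi.single (⟨0, h0⟩ : Fin J) m) (Pi.single (⟨0, h0⟩ : Fin J) m') = u k * e m m')
    {k : ℕ} (hk : k < J) (x : Fin J → M) (y : Fin J → M') :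
    Φ k x y = ∑ j ∈ range (k + 1), u j * convCoeff e J (k - j) x y := by
  -- the weighted family as a family of bi-additive maps
  let Ψ : ℕ → (Fin J → M) →+ (Fin J → M') →+ R := fun k =>
    ∑ j ∈ range (k + 1), u j • convCoeffHom e J (k - j)
  have hΨ : ∀ k x y, Ψ k x y = ∑ j ∈ range (k + 1), u j * convCoeff e J (k - j) x y := by
    intro k x y
    simp only [Ψ, AddMonoidHom.finsetSum_apply, AddMonoidHom.smul_apply, convCoeffHom_apply, smul_eq_mul]
  rw [← hΨ]
  refine family_eq_of_single_zero_eq Φ Ψ hL0 hLs hR0 hRs ?_ ?_ ?_ ?_ ?_ hk x y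
  · intro x y; rw [hΨ]; exact weightedConv_zero_shiftEnd_left e u x y
  · intro k x y hk; rw [hΨ, hΨ]; exact weightedConv_succ_shiftEnd_left e u hk x y
  · intro x y; rw [hΨ]; exact weightedConv_zero_shiftEnd_right e u x y
  · intro k x y hk; rw [hΨ, hΨ]; exact weightedConv_succ_shiftEnd_right e u hk x y
  · intro k hk m m' h0
    rw [hδ k hk m m' h0, hΨ]
    exact (weightedConv_single_zero_single_zero e u hk m m').symm

end Series

end Summit.BirchSwinnertonDyer.BirchSwinnertonDyer.Rank1Residual.LocalSplitPrime

end
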